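import Summits.Ventures.HSemireg.WedgeHankelRecurrenceGaussDiscriminantLowerBound

/-!
# Venture HSemireg — **FURTHER STIELTJES SUM RULES FOR THE JACOBI ZEROS AND THE GEGENBAUER SUM RULE ON `λ > −½`**: from N412's `Σ 1∕(1−x_k) = (t+1)(t+σ+2)∕(2(α+1))`,
# `Σ 1∕(1+x_k) = (t+1)(t+σ+2)∕(2(β+1))` one gets **`Σ_k 1∕(1−x_k²) = ((t+1)(t+σ+2)∕4)(1∕(α+1) + 1∕(β+1))`**, **`Σ_k x_k∕(1−x_k²) = ((t+1)(t+σ+2)∕4)(1∕(α+1) − 1∕(β+1))`**, and, through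
# N414, the ultraspherical rule **`Σ_k 1∕(1−x_k²) = (t+1)(t+1+2λ)∕(2λ+1)`** now for every `λ > −½`, `λ ≠ 0` (N398 had `λ > 0`)

HONEST FRAMING. Part of the Lean index of the computation cell `pub-hsemireg` (seat p10 gen 47, Sunday typer «UNIFORM-IN-n»).  Finite sums of rational expressions only; no variety, no cohomology
theory, no sheaf, no Ext group and no semiregularity map is constructed here; nothing here says that HC / HC_CM / HC_AV holds; no Literature fact (unproved `Prop`) is declared or used.  Custodian
versions as in `WedgeHankelSiegelIdeal` (1/3).
SOURCES (cited).  S. Ahmed, M. Bruschi, F. Calogero, M. A. Olshanetsky, A. M. Perelomov, Nuovo Cimento B 49 (1979) 173–199, §4 (sum rules for Jacobi zeros); G. Szegő, *Orthogonal Polynomials*,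
§6.7; K. M. Case, *Sum rules for zeros of polynomials I*, J. Math. Phys. 21 (1980) 702–708.
PROOF TYPED HERE.  Partial fractions `1∕(1−x²) = ½(1∕(1−x) + 1∕(1+x))`, `x∕(1−x²) = ½(1∕(1−x) − 1∕(1+x))` summed over the zeros; N412 `jacobi_zeros_sum_inv_one_sub ∕ _one_add`; for Gegenbauer the
Jacobi data of N414 `gegenbauer_jacobi_data` with `α = β = λ − ½`.
DEDUP DISCLOSURE (`rg -n 'sum_inv_one_sub_sq' Summits/Ventures/HSemireg/WedgeHankelRecurrenceGauss*`, 2026-09-04): N398 `gegenbauer_zeros_sum_inv_one_sub_sq` (`λ > 0`), `legendre_…`; the Jacobi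
rules and the extended range are new; 0 hits for the 3 names below.

WHAT IS IN THE TREE.  N412 `jacobi_zeros_sum_inv_one_sub`, `jacobi_zeros_sum_inv_one_add`; N414 `gegenbauer_jacobi_data`.
THIS FILE (namespace `Summit.Ventures.HSemireg.Wedge.HankelOuter` continued; CHAINED on N422 (import only); 0 definitions):
* §1188 **`jacobi_zeros_sum_inv_one_sub_sq`**, **`jacobi_zeros_sum_div_one_sub_sq`**, **`gegenbauer_zeros_sum_inv_one_sub_sq'`** (`−½ < λ`, `λ ≠ 0`).
CAVEATS.  As N412 (zeros by hypothesis, `α, β > −1`).  Nothing Ext-side.  New names only.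
-/

open Module Polynomial
open scoped Matrix Polynomial

namespace Summit.Ventures.HSemireg.Wedge.HankelOuter

/-! ## §1188. Jacobi sum rules for `1∕(1−x²)` and `x∕(1−x²)` -/

/-- **`Σ_k 1∕(1 − x_k²) = ((t+1)(t+α+β+2)∕4) · (1∕(α+1) + 1∕(β+1))`** for the Jacobi zeros. [Ahmed et al. 1979 §4; this file, §1188] -/
theorem jacobi_zeros_sum_inv_one_sub_sq {q : ℕ → ℝ[X]} {a b : ℕ → ℝ} {α β : ℝ} (hq0 : q 0 = 1) (hq1 : q 1 = Polynomial.X - C (a 0))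
    (hrec : ∀ n, q (n + 2) = (Polynomial.X - C (a (n + 1))) * q (n + 1) - C (b (n + 1)) * q n) (hα : -1 < α) (hβ : -1 < β) (ha0 : a 0 = (β - α) / (α + β + 2))
    (ha : ∀ n : ℕ, a (n + 1) = (β ^ 2 - α ^ 2) / ((2 * n + 2 + (α + β)) * (2 * n + 4 + (α + β))))
    (hb1 : b 1 = 4 * (1 + α) * (1 + β) / ((α + β + 2) ^ 2 * (α + β + 3)))
    (hb : ∀ n : ℕ, b (n + 2) = 4 * ((n : ℝ) + 2) * ((n : ℝ) + 2 + α) * ((n : ℝ) + 2 + β) * ((n : ℝ) + 2 + (α + β)) /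
      ((2 * n + 3 + (α + β)) * (2 * n + 4 + (α + β)) ^ 2 * (2 * n + 5 + (α + β))))
    {t : ℕ} {x : Fin (t + 1) → ℝ} (hx : StrictMono x) (hxq : q (t + 1) = ∏ k, (Polynomial.X - C (x k))) (hmem : ∀ k, -1 < x k ∧ x k < 1) :
    ∑ k, (1 - x k ^ 2)⁻¹ = ((t : ℝ) + 1) * ((t : ℝ) + 2 + (α + β)) / 4 * ((α + 1)⁻¹ + (β + 1)⁻¹) := by
  have hP := jacobi_zeros_sum_inv_one_sub hq0 hq1 hrec hα hβ ha0 ha hb1 hb hx hxq hmem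
  have hM := jacobi_zeros_sum_inv_one_add hq0 hq1 hrec hα hβ ha0 ha hb1 hb hx hxq hmem
  have hsplit : ∀ k, (1 - x k ^ 2)⁻¹ = ((1 - x k)⁻¹ + (1 + x k)⁻¹) / 2 := fun k => by
    have h1 : 1 - x k ≠ 0 := by linarith [(hmem k).2]
    have h2 : 1 + x k ≠ 0 := by linarith [(hmem k).1]
    have h3 : 1 - x k ^ 2 ≠ 0 := by nlinarith [(hmem k).1, (hmem k).2]
    field_simp; ring
  simp_rw [hsplit]
  rw [← Finset.sum_div, Finset.sum_add_distrib, hP, hM]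
  have hα1 : α + 1 ≠ 0 := by linarith
  have hβ1 : β + 1 ≠ 0 := by linarith
  field_simp
  ring

/-- **`Σ_k x_k∕(1 − x_k²) = ((t+1)(t+α+β+2)∕4) · (1∕(α+1) − 1∕(β+1))`** for the Jacobi zeros. [Ahmed et al. 1979 §4; this file, §1188] -/
theorem jacobi_zeros_sum_div_one_sub_sq {q : ℕ → ℝ[X]} {a b : ℕ → ℝ} {α β : ℝ} (hq0 : q 0 = 1) (hq1 : q 1 = Polynomial.X - C (a 0))
    (hrec : ∀ n, q (n + 2) = (Polynomial.X - C (a (n + 1))) * q (n + 1) - C (b (n + 1)) * q n) (hα : -1 < α) (hβ : -1 < β) (ha0 : a 0 = (β - α) / (α + β + 2))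
    (ha : ∀ n : ℕ, a (n + 1) = (β ^ 2 - α ^ 2) / ((2 * n + 2 + (α + β)) * (2 * n + 4 + (α + β))))
    (hb1 : b 1 = 4 * (1 + α) * (1 + β) / ((α + β + 2) ^ 2 * (α + β + 3)))
    (hb : ∀ n : ℕ, b (n + 2) = 4 * ((n : ℝ) + 2) * ((n : ℝ) + 2 + α) * ((n : ℝ) + 2 + β) * ((n : ℝ) + 2 + (α + β)) /
      ((2 * n + 3 + (α + β)) * (2 * n + 4 + (α + β)) ^ 2 * (2 * n + 5 + (α + β))))
    {t : ℕ} {x : Fin (t + 1) → ℝ} (hx : StrictMono x) (hxq : q (t + 1) = ∏ k, (Polynomial.X - C (x k))) (hmem : ∀ k, -1 < x k ∧ x k < 1) :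
    ∑ k, x k / (1 - x k ^ 2) = ((t : ℝ) + 1) * ((t : ℝ) + 2 + (α + β)) / 4 * ((α + 1)⁻¹ - (β + 1)⁻¹) := by
  have hP := jacobi_zeros_sum_inv_one_sub hq0 hq1 hrec hα hβ ha0 ha hb1 hb hx hxq hmem
  have hM := jacobi_zeros_sum_inv_one_add hq0 hq1 hrec hα hβ ha0 ha hb1 hb hx hxq hmem
  have hsplit : ∀ k, x k / (1 - x k ^ 2) = ((1 - x k)⁻¹ - (1 + x k)⁻¹) / 2 := fun k => by
    have h1 : 1 - x k ≠ 0 := by linarith [(hmem k).2]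
    have h2 : 1 + x k ≠ 0 := by linarith [(hmem k).1]
    have h3 : 1 - x k ^ 2 ≠ 0 := by nlinarith [(hmem k).1, (hmem k).2]
    field_simp; ring
  simp_rw [hsplit]
  rw [← Finset.sum_div, Finset.sum_sub_distrib, hP, hM]
  have hα1 : α + 1 ≠ 0 := by linarith
  have hβ1 : β + 1 ≠ 0 := by linarith
  field_simp
  ring

/-- **GEGENBAUER ON `λ > −½`, `λ ≠ 0`: `Σ_k 1∕(1 − x_k²) = (t+1)(t+1+2λ)∕(2λ+1)`** (N398 for `λ > 0`). [Ahmed et al. 1979; Case 1980; this file, §1188] -/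
theorem gegenbauer_zeros_sum_inv_one_sub_sq' {q : ℕ → ℝ[X]} {a b : ℕ → ℝ} {lam : ℝ} (hq0 : q 0 = 1) (hq1 : q 1 = Polynomial.X - C (a 0))
    (hrec : ∀ n, q (n + 2) = (Polynomial.X - C (a (n + 1))) * q (n + 1) - C (b (n + 1)) * q n) (ha : ∀ n, a n = 0)
    (hb : ∀ n, b (n + 1) = ((n : ℝ) + 1) * ((n : ℝ) + 2 * lam) / (4 * ((n : ℝ) + 1 + lam) * ((n : ℝ) + lam))) (hlam : -1 / 2 < lam) (hlam0 : lam ≠ 0)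
    {t : ℕ} {x : Fin (t + 1) → ℝ} (hx : StrictMono x) (hxq : q (t + 1) = ∏ k, (Polynomial.X - C (x k))) (hmem : ∀ k, -1 < x k ∧ x k < 1) :
    ∑ k, (1 - x k ^ 2)⁻¹ = ((t : ℝ) + 1) * ((t : ℝ) + 1 + 2 * lam) / (2 * lam + 1) := by
  obtain ⟨h0, h1, h2, h3⟩ := gegenbauer_jacobi_data ha hb hlam hlam0
  rw [jacobi_zeros_sum_inv_one_sub_sq hq0 hq1 hrec (by linarith) (by linarith) h0 h1 h2 h3 hx hxq hmem]
  have h : lam - 1 / 2 + 1 ≠ 0 := by intro h; apply hlam0; linarith [h]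
  have h' : 2 * lam + 1 ≠ 0 := by linarith
  have h'' : lam + 1 / 2 ≠ 0 := by intro hh; apply h'; linarith
  rw [show lam - 1 / 2 + 1 = lam + 1 / 2 by ring]
  field_simp
  ring

end Summit.Ventures.HSemireg.Wedge.HankelOuter
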